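import Summits.BirchSwinnertonDyer.BirchSwinnertonDyer.Theorems.PencilClassSchneiderDoor
import Summits.BirchSwinnertonDyer.BirchSwinnertonDyer.Theorems.DerivedCoinvariantProfileDischarged
import Literature.NumberTheory.EllipticCurves.MordellWeilTheoremProofs
import HarnessLib

/-!
# The pencil-class corank door: the equality input on an index-zero class is EXACTLY `corank Sel_{p^∞} ≤ 2`

Cell `bsd-rank2`, seat p2, GEN 73 (K73-A). Sequel to `PencilClassSchneiderDoor` (K72) and
`DerivedCoinvariantProfileDischarged` (K70-A). Theorems only; every hypothesis explicit.

K72 showed: on an ANALYTIC CLASS of a family `E τ` with sections `P τ, Q τ` (one restricted power series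
`Σ aₙ Xⁿ` interpolating the pair regulator `Reg_p(τ) = ⟨P,P⟩⟨Q,Q⟩ − ⟨P,Q⟩²` at the positions `param τ ∈ ℤ_p`)
carrying an index-`0` Strassman certificate, EVERY member with `rank E_τ(ℚ) = 2` and `Ш(E_τ/ℚ)[p^∞]` finite has
`ord_{T=0} L_p(E_τ,T) = 2` (granting the prints PRS = `Schneider1985_order_charGenerator` and
BCS = `burungale_castella_skinner_charIdeal_eq_padicLFunction`; `p ≥ 5` good ordinary, `ρ̄` irreducible).

This file closes the circle and names the equality input EXACTLY:

* §0 (pure algebra, [folklore]): a family of points with non-zero `p`-adic Gram determinant is `ℤ`-linearly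
  independent in `E(ℚ)`, hence has at most `rank E(ℚ)` members (Mordell–Weil, the tree's proved
  `module_finite_point_holds`); two points with `Reg_p(P,Q) ≠ 0` force `2 ≤ rank E(ℚ)`.
* §1 (one curve, two points with `Reg_p(P,Q) ≠ 0`): `corank_{ℤ_p} Sel_{p^∞}(E/ℚ) ≤ 2 ⟺ corank = 2 ⟺
  (rank E(ℚ) = 2 ∧ Ш(E/ℚ)[p^∞] finite)`; and from KATO'S THEOREM 17.4 ALONE (`kato_divisibility`):
  `ord_{T=0} L_p(E,T) ≤ 2 ⟹ rank = 2, corank Ш[p^∞] = 0, every higher derived length e_i(X(E/ℚ_∞)) = 0, (MC_T),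
  ord = 2` (the squeeze of K70-A with `ord ≤ 2 ≤ rank`). So NECESSITY of the equality input costs no conjecture.
* §2 (one curve, PRS + BCS): the six conditions `ord = 2`, `ord ≤ 2`, `corank Sel ≤ 2`, `corank Sel = 2`,
  `rank = 2 ∧ Ш[p^∞] finite`, `rank = 2 ∧ corank Ш[p^∞] = 0` are EQUIVALENT (`List.TFAE`).
* §3 (the class): on an index-`0` class every member has `rank ≥ 2`, and per member the TFAE of §2 holds; on a
  class with ONE non-degenerate member the same holds off the finite degenerate set (Strassman).

Reading for the cell (Barrier B1 honesty): on an infinite index-`0` class the `p`-adic BSD rank equality at the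
generic value, `ord_{T=0} L_p(E_τ,T) = 2`, holds for the member `τ` IF AND ONLY IF
`corank_{ℤ_p} Sel_{p^∞}(E_τ/ℚ) ≤ 2`; the failure set is `{τ : rank E_τ(ℚ) ≥ 3} ∪ {τ : rank = 2, Ш(E_τ)[p^∞] infinite}`.
There is no slack and no substitute: the extra input IS `Ш[p^∞]`-finiteness (plus `rank ≤ 2`), member by
member — `S0` is not moved, it is located exactly.

References: Mazur–Tate–Teitelbaum 1986 §II.4 [MazurTateTeitelbaum1986Invent]; Schneider 1985 [Schneider1985];
Balakrishnan–Müller–Stein 2016 Thm. 1.7 [BalakrishnanMullerStein2015]; Kato 2004 Thm. 17.4 [Kato2004Asterisque];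
Greenberg LNM 1716 [GreenbergLNM1716]; Gouvêa, *p-adic Numbers*, Thm. 5.6.1 [Gouvea1993PadicNumbers];
Silverman AEC VIII.6 [SilvermanAEC2009].
-/

set_option linter.dupNamespace false

noncomputable section

open Filter Topology
open scoped BigOperators
open scoped MatrixGroups ModularForm
open CongruenceSubgroup WeierstrassCurve
open Literature.NumberTheory.EllipticCurves Literature.NumberTheory.EllipticCurves.IwasawaAlgebra
  Literature.NumberTheory.EllipticCurves.ModularForms
open Summit.BirchSwinnertonDyer.BirchSwinnertonDyer.Theorems.DerivedCoinvariantProfileSchneider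
  Summit.BirchSwinnertonDyer.BirchSwinnertonDyer.Theorems.DerivedCoinvariantProfileAtPoint
  Summit.BirchSwinnertonDyer.BirchSwinnertonDyer.Theorems.DerivedCoinvariantProfile
  Summit.BirchSwinnertonDyer.BirchSwinnertonDyer.Theorems.DerivedCoinvariantProfileDischarged
  Summit.BirchSwinnertonDyer.BirchSwinnertonDyer.Theorems.PencilClassSchneiderDoor

namespace Summit.BirchSwinnertonDyer.BirchSwinnertonDyer.Theorems.PencilClassCorankDoor

variable {p : ℕ} [Fact p.Prime]

/-! ## §0 Non-zero Gram determinant ⇒ independence ⇒ `card ≤ rank` -/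

/-- A family of rational points whose `p`-adic height Gram determinant is non-zero is `ℤ`-linearly independent
in `E(ℚ)`: a dependency `Σ cᵢ Pᵢ = 0` with `c ≠ 0` gives `c · G = 0` for the Gram matrix `G` (bilinearity), so
`det G = 0`. [cite: MazurTateTeitelbaum1986Invent, §II.4] -/
theorem linearIndependent_of_padicRegulatorOf_ne_zero {W : WeierstrassCurve ℚ} (D : PAdicHeightData W p)
    {ι : Type*} [Fintype ι] {P : ι → W.toAffine.Point} (h : padicRegulatorOf D P ≠ 0) :
    LinearIndependent ℤ P := by
  classical
  by_contra hP
  obtain ⟨g, hg0, i, hi⟩ := Fintype.not_linearIndependent_iff.mp hP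
  apply h
  rw [padicRegulatorOf, ← Matrix.exists_vecMul_eq_zero_iff]
  refine ⟨fun i ↦ (g i : ℚ_[p]), ?_, ?_⟩
  · intro hz
    exact hi (by simpa using congr_fun hz i)
  · funext j
    have hsum : D.pairing.flip (P j) (∑ i, g i • P i) = 0 := by
      rw [hg0, map_zero]
    rw [map_sum] at hsum
    simp only [map_zsmul, AddMonoidHom.flip_apply, zsmul_eq_mul] at hsum
    simpa [Matrix.vecMul, dotProduct, PAdicHeightData.pairingMatrix] using hsum

/-- Hence such a family has at most `rank E(ℚ)` members (Mordell–Weil: `E(ℚ)` is finitely generated, the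
tree's proved `module_finite_point_holds`; invariance of rank over `ℤ`). [cite: SilvermanAEC2009, VIII.6] -/
theorem card_le_mordellWeilRank_of_padicRegulatorOf_ne_zero {W : WeierstrassCurve ℚ} [W.IsElliptic]
    (D : PAdicHeightData W p) {ι : Type*} [Fintype ι] {P : ι → W.toAffine.Point}
    (h : padicRegulatorOf D P ≠ 0) : Fintype.card ι ≤ W.mordellWeilRank := by
  have hli := linearIndependent_of_padicRegulatorOf_ne_zero D h
  -- the `DecidableEq ℚ` instances hidden in the group law of `E(ℚ)` (classical inside `mordellWeilRank` and
  -- the Mordell–Weil theorem, `instDecidableEqRat` here) are reconciled by `convert`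
  haveI : Module.Finite ℤ W.toAffine.Point := by convert W.module_finite_point_holds
  unfold WeierstrassCurve.mordellWeilRank
  convert hli.fintype_card_le_finrank

/-- **Two points with `Reg_p(P,Q) ≠ 0` force `rank E(ℚ) ≥ 2`.** [cite: MazurTateTeitelbaum1986Invent, §II.4] -/
theorem two_le_mordellWeilRank_of_pair_ne_zero {W : WeierstrassCurve ℚ} [W.IsElliptic]
    (D : PAdicHeightData W p) (P Q : W.toAffine.Point) (h : padicRegulatorOf D ![P, Q] ≠ 0) :
    2 ≤ W.mordellWeilRank := by
  simpa using card_le_mordellWeilRank_of_padicRegulatorOf_ne_zero D h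

/-! ## §1 One curve, two points with non-zero pair regulator -/

section OneCurve

variable (W : WeierstrassCurve ℚ) [W.IsElliptic] [W.IsGloballyMinimal]
  {D : PAdicHeightData W p} {P Q : W.toAffine.Point}

omit [W.IsGloballyMinimal] in
/-- **The corank dictionary.** With `Reg_p(P,Q) ≠ 0`: `corank_{ℤ_p} Sel_{p^∞}(E/ℚ) ≤ 2 ⟺ rank E(ℚ) = 2 ∧
corank_{ℤ_p} Ш(E/ℚ)[p^∞] = 0` (Kummer: `corank Sel = rank + corank Ш`, and `rank ≥ 2`). [cite: GreenbergLNM1716, §1 p. 65] -/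
theorem selmerCorank_le_two_iff (h : padicRegulatorOf D ![P, Q] ≠ 0) :
    W.selmerCorank p ≤ 2 ↔ W.mordellWeilRank = 2 ∧ W.shaCorank p = 0 := by
  have h2 := two_le_mordellWeilRank_of_pair_ne_zero D P Q h
  rw [W.selmerCorank_eq_mordellWeilRank_add_holds p]
  omega

omit [W.IsGloballyMinimal] in
/-- Same with `Ш[p^∞]` finite in place of corank zero (`Ш[p^∞]` is cofinitely generated). [cite: GreenbergLNM1716, §1 p. 65] -/
theorem selmerCorank_le_two_iff_finite_sha (h : padicRegulatorOf D ![P, Q] ≠ 0) :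
    W.selmerCorank p ≤ 2 ↔ W.mordellWeilRank = 2 ∧ Finite (AddCommGroup.primaryComponent W.sha p) := by
  rw [selmerCorank_le_two_iff W h, finite_primaryComponent_sha_iff_shaCorank_eq_zero W p]

omit [W.IsGloballyMinimal] in
/-- With `Reg_p(P,Q) ≠ 0`, `corank Sel ≤ 2 ⟺ corank Sel = 2`. [cite: GreenbergLNM1716, §1 p. 65] -/
theorem selmerCorank_le_two_iff_eq_two (h : padicRegulatorOf D ![P, Q] ≠ 0) :
    W.selmerCorank p ≤ 2 ↔ W.selmerCorank p = 2 := by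
  have h2 := two_le_mordellWeilRank_of_pair_ne_zero D P Q h
  have hid := W.selmerCorank_eq_mordellWeilRank_add_holds p
  omega

variable {N : ℕ} [NeZero N] {f : CuspForm (Gamma0 N) 2} {κ : ZpExtension ℚ p} {γ : Field.absoluteGaloisGroup ℚ}

/-- **NECESSITY FROM KATO ALONE (the squeeze at `2`).** Odd good ordinary `p`, `kato_divisibility` only: if two
points have `Reg_p(P,Q) ≠ 0` (any height datum) and `ord_{T=0} L_p(E,T) ≤ 2`, then `rank E(ℚ) = 2`,
`corank Ш[p^∞] = 0`, every derived length `e_{i+1}(X(E/ℚ_∞)) = 0` (`i ≥ 1`), `(MC_T)` holds and `ord = 2`.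
Proof: `ord ≤ 2 ≤ rank` (§0) feeds K70-A's squeeze. [cite: Kato2004Asterisque, Thm. 17.4] [cite: GreenbergLNM1716, Thm. 1.2] -/
theorem squeeze_at_two_of_kato (hK : kato_divisibility W p (κ := κ) (γ := γ) (f := f)) (hp : p ≠ 2)
    (hord : IsOrdinaryAt W p) (hκ : κ.IsCyclotomic) (hγ : κ.IsTopGenerator γ)
    (hγ' : IsCyclotomicVariable p γ) (hf : IsNewformOf W f) (Dsel : W.SelmerDualData κ γ)
    (h : padicRegulatorOf D ![P, Q] ≠ 0) (hle : (padicLFunction f (unitRoot W p : ℚ_[p])).order ≤ 2) :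
    W.mordellWeilRank = 2 ∧ W.shaCorank p = 0 ∧ (∀ i, 1 ≤ i → derivedLength p Dsel.X i = 0) ∧
      Module.lengthAt (IwasawaAlgebra p) Dsel.X (primeT p) =
        (padicLFunction f (unitRoot W p : ℚ_[p])).order ∧
      (padicLFunction f (unitRoot W p : ℚ_[p])).order = 2 := by
  have h2 := two_le_mordellWeilRank_of_pair_ne_zero D P Q h
  have hle' : (padicLFunction f (unitRoot W p : ℚ_[p])).order ≤ W.mordellWeilRank :=
    hle.trans (by exact_mod_cast h2)
  obtain ⟨hsha, he, hℓ, hord'⟩ :=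
    defects_eq_zero_of_order_le_rank_of_kato p W f hK hp hord hκ hγ hγ' hf Dsel hle'
  have hr : (W.mordellWeilRank : ℕ∞) ≤ 2 := hord' ▸ hle
  have hr2 : W.mordellWeilRank = 2 := le_antisymm (by exact_mod_cast hr) h2
  exact ⟨hr2, hsha, he, hℓ, by rw [hord', hr2]; rfl⟩

/-- Contrapositive for the cell: `Reg_p(P,Q) ≠ 0` and `corank Sel_{p^∞}(E/ℚ) ≥ 3` (a third independent point, or
infinite `Ш[p^∞]`) force `3 ≤ ord_{T=0} L_p(E,T)` — from Kato alone. [cite: Kato2004Asterisque, Thm. 17.4] -/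
theorem three_le_order_of_kato_of_two_lt_selmerCorank
    (hK : kato_divisibility W p (κ := κ) (γ := γ) (f := f)) (hp : p ≠ 2)
    (hord : IsOrdinaryAt W p) (hκ : κ.IsCyclotomic) (hγ : κ.IsTopGenerator γ)
    (hγ' : IsCyclotomicVariable p γ) (hf : IsNewformOf W f) (Dsel : W.SelmerDualData κ γ)
    (h : padicRegulatorOf D ![P, Q] ≠ 0) (hS : 2 < W.selmerCorank p) :
    3 ≤ (padicLFunction f (unitRoot W p : ℚ_[p])).order := by
  by_contra hlt
  have hle : (padicLFunction f (unitRoot W p : ℚ_[p])).order ≤ 2 := by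
    rw [not_le] at hlt
    exact Order.le_of_lt_succ hlt
  obtain ⟨hr2, hsha, -, -, -⟩ := squeeze_at_two_of_kato W hK hp hord hκ hγ hγ' hf Dsel h hle
  have hid := W.selmerCorank_eq_mordellWeilRank_add_holds p
  omega

/-- **THE SIX-WAY DOOR at one curve (PRS + BCS).** `p ≥ 5` good ordinary, `ρ̄` irreducible, canonical height `D`,
two points with `Reg_p(P,Q) ≠ 0`. Equivalent: `ord_{T=0} L_p = 2`; `ord ≤ 2`; `corank Sel_{p^∞} ≤ 2`; `= 2`;
`rank = 2 ∧ Ш[p^∞]` finite; `rank = 2 ∧ corank Ш[p^∞] = 0`. CONDITIONAL on PRS, BCS.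
[cite: BalakrishnanMullerStein2015, Thm. 1.7] [cite: Schneider1985, Thm. 2′ (p. 342)] [cite: MazurTateTeitelbaum1986Invent, §II.4] -/
theorem order_eq_two_tfae (h85 : Schneider1985_order_charGenerator)
    (hBCS : burungale_castella_skinner_charIdeal_eq_padicLFunction) (hp : 5 ≤ p)
    (hgood : W.HasGoodReductionAtPrime p) (hord : ¬ (p : ℤ) ∣ W.frobeniusTrace p)
    (hirr : W.HasIrreducibleModPGaloisRep p) (hf : IsNewformOf W f) (hD : D.IsCanonical)
    (h : padicRegulatorOf D ![P, Q] ≠ 0) :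
    List.TFAE [(padicLFunction f (unitRoot W p : ℚ_[p])).order = 2,
      (padicLFunction f (unitRoot W p : ℚ_[p])).order ≤ 2,
      W.selmerCorank p ≤ 2, W.selmerCorank p = 2,
      W.mordellWeilRank = 2 ∧ Finite (AddCommGroup.primaryComponent W.sha p),
      W.mordellWeilRank = 2 ∧ W.shaCorank p = 0] := by
  have h2 := two_le_mordellWeilRank_of_pair_ne_zero D P Q h
  tfae_have 1 → 2 := fun h1 ↦ h1.le
  tfae_have 2 → 6 := by
    intro hle
    obtain ⟨κ, hκ, γ, hγ, hγ'⟩ := exists_isCyclotomic_isTopGenerator_isCyclotomicVariable_holds p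
    obtain ⟨Dsel⟩ := W.nonempty_selmerDualData_holds κ γ hγ
    obtain ⟨n₀, hn₀⟩ :=
      order_eq_rank_add_shaCorank_add_sum_derivedLength_of_BCS p W f hBCS hp hgood hord hirr hκ hγ hγ' hf Dsel
    obtain ⟨heq, -⟩ := hn₀ n₀ le_rfl
    have hrs : (W.mordellWeilRank : ℕ∞) + W.shaCorank p ≤ 2 := le_trans le_self_add (heq ▸ hle)
    have hrs' : W.mordellWeilRank + W.shaCorank p ≤ 2 := by exact_mod_cast hrs
    omega
  tfae_have 6 ↔ 5 := by rw [finite_primaryComponent_sha_iff_shaCorank_eq_zero W p]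
  tfae_have 5 → 1 := fun ⟨hr, hfin⟩ ↦ by
    rw [order_eq_rank_of_pair_ne_zero W h85 hBCS hp hgood hord hirr hf hD P Q hr h hfin, hr]; rfl
  tfae_have 3 ↔ 6 := selmerCorank_le_two_iff W h
  tfae_have 3 ↔ 4 := selmerCorank_le_two_iff_eq_two W h
  tfae_finish

/-- The headline pair: `ord_{T=0} L_p(E,T) = 2 ⟺ corank_{ℤ_p} Sel_{p^∞}(E/ℚ) ≤ 2`. CONDITIONAL on PRS, BCS.
[cite: BalakrishnanMullerStein2015, Thm. 1.7] [cite: MazurTateTeitelbaum1986Invent, §II.4] -/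
theorem order_eq_two_iff_selmerCorank_le_two (h85 : Schneider1985_order_charGenerator)
    (hBCS : burungale_castella_skinner_charIdeal_eq_padicLFunction) (hp : 5 ≤ p)
    (hgood : W.HasGoodReductionAtPrime p) (hord : ¬ (p : ℤ) ∣ W.frobeniusTrace p)
    (hirr : W.HasIrreducibleModPGaloisRep p) (hf : IsNewformOf W f) (hD : D.IsCanonical)
    (h : padicRegulatorOf D ![P, Q] ≠ 0) :
    (padicLFunction f (unitRoot W p : ℚ_[p])).order = 2 ↔ W.selmerCorank p ≤ 2 :=
  (order_eq_two_tfae W h85 hBCS hp hgood hord hirr hf hD h).out 0 2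

end OneCurve

/-! ## §3 On a pencil class -/

section Class

variable {T : Type*} {E : T → WeierstrassCurve ℚ} [∀ τ, (E τ).IsElliptic] [∀ τ, (E τ).IsGloballyMinimal]
  {P Q : ∀ τ, (E τ).toAffine.Point} {Dh : ∀ τ, PAdicHeightData (E τ) p}
  (param : T → ℤ_[p]) (coeff : ℕ → ℚ_[p])

omit [∀ τ, (E τ).IsGloballyMinimal] in
/-- **Every member of an index-zero class has `rank ≥ 2`** (no conjecture: Strassman index `0` ⇒ `Reg_p(τ) ≠ 0`
⇒ `P τ, Q τ` independent ⇒ Mordell–Weil). [cite: Gouvea1993PadicNumbers, §5.6 Thm. 5.6.1] [cite: MazurTateTeitelbaum1986Invent, §II.4] -/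
theorem two_le_rank_of_index_zero (hcoeff : Tendsto coeff atTop (𝓝 0))
    (hreg : ∀ τ, padicRegulatorOf (Dh τ) ![P τ, Q τ] = ∑' n, coeff n * (param τ : ℚ_[p]) ^ n)
    (hcert : ∀ n, 0 < n → ‖coeff n‖ < ‖coeff 0‖) (τ : T) : 2 ≤ (E τ).mordellWeilRank :=
  two_le_mordellWeilRank_of_pair_ne_zero (Dh τ) (P τ) (Q τ)
    (regulator_ne_zero_of_index_zero param coeff hcoeff hreg hcert τ)

/-- **THE CORANK DOOR on an index-zero class.** Granting PRS and BCS, for EVERY member `E τ` at a good ordinary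
`p ≥ 5` with irreducible `ρ̄` and canonical `Dh τ`, the six conditions of `order_eq_two_tfae` are equivalent; in
particular `ord_{T=0} L_p(E_τ,T) = 2 ⟺ corank_{ℤ_p} Sel_{p^∞}(E_τ/ℚ) ≤ 2 ⟺ (rank E_τ(ℚ) = 2 ∧ Ш(E_τ/ℚ)[p^∞] finite)`.
The equality input beyond the prints and the class certificate is EXACTLY `corank Sel ≤ 2`, member by member.
CONDITIONAL on PRS, BCS. [cite: BalakrishnanMullerStein2015, Thm. 1.7] [cite: Gouvea1993PadicNumbers, §5.6 Thm. 5.6.1] -/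
theorem order_eq_two_tfae_of_index_zero (hcoeff : Tendsto coeff atTop (𝓝 0))
    (hreg : ∀ τ, padicRegulatorOf (Dh τ) ![P τ, Q τ] = ∑' n, coeff n * (param τ : ℚ_[p]) ^ n)
    (hcert : ∀ n, 0 < n → ‖coeff n‖ < ‖coeff 0‖) (h85 : Schneider1985_order_charGenerator)
    (hBCS : burungale_castella_skinner_charIdeal_eq_padicLFunction) (hp : 5 ≤ p) (τ : T)
    (hgood : (E τ).HasGoodReductionAtPrime p) (hord : ¬ (p : ℤ) ∣ (E τ).frobeniusTrace p)
    (hirr : (E τ).HasIrreducibleModPGaloisRep p) {N : ℕ} [NeZero N] {f : CuspForm (Gamma0 N) 2}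
    (hf : IsNewformOf (E τ) f) (hDh : (Dh τ).IsCanonical) :
    List.TFAE [(padicLFunction f (unitRoot (E τ) p : ℚ_[p])).order = 2,
      (padicLFunction f (unitRoot (E τ) p : ℚ_[p])).order ≤ 2,
      (E τ).selmerCorank p ≤ 2, (E τ).selmerCorank p = 2,
      (E τ).mordellWeilRank = 2 ∧ Finite (AddCommGroup.primaryComponent (E τ).sha p),
      (E τ).mordellWeilRank = 2 ∧ (E τ).shaCorank p = 0] :=
  order_eq_two_tfae (E τ) h85 hBCS hp hgood hord hirr hf hDh
    (regulator_ne_zero_of_index_zero param coeff hcoeff hreg hcert τ)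

/-- **Necessity on the class from Kato alone.** On an index-zero class, at an odd good ordinary `p`, granting only
`kato_divisibility` for the member: `ord_{T=0} L_p(E_τ,T) ≤ 2` forces `rank E_τ(ℚ) = 2`, `corank Ш(E_τ)[p^∞] = 0`,
all higher derived lengths of `X(E_τ/ℚ_∞)` zero, `(MC_T)` and `ord = 2`. [cite: Kato2004Asterisque, Thm. 17.4] [cite: Gouvea1993PadicNumbers, §5.6 Thm. 5.6.1] -/
theorem squeeze_at_two_of_index_zero_of_kato (hcoeff : Tendsto coeff atTop (𝓝 0))
    (hreg : ∀ τ, padicRegulatorOf (Dh τ) ![P τ, Q τ] = ∑' n, coeff n * (param τ : ℚ_[p]) ^ n)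
    (hcert : ∀ n, 0 < n → ‖coeff n‖ < ‖coeff 0‖) (τ : T) {N : ℕ} [NeZero N]
    {f : CuspForm (Gamma0 N) 2} {κ : ZpExtension ℚ p} {γ : Field.absoluteGaloisGroup ℚ}
    (hK : kato_divisibility (E τ) p (κ := κ) (γ := γ) (f := f)) (hp : p ≠ 2)
    (hord : IsOrdinaryAt (E τ) p) (hκ : κ.IsCyclotomic) (hγ : κ.IsTopGenerator γ)
    (hγ' : IsCyclotomicVariable p γ) (hf : IsNewformOf (E τ) f) (Dsel : (E τ).SelmerDualData κ γ)
    (hle : (padicLFunction f (unitRoot (E τ) p : ℚ_[p])).order ≤ 2) :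
    (E τ).mordellWeilRank = 2 ∧ (E τ).shaCorank p = 0 ∧ (∀ i, 1 ≤ i → derivedLength p Dsel.X i = 0) ∧
      Module.lengthAt (IwasawaAlgebra p) Dsel.X (primeT p) =
        (padicLFunction f (unitRoot (E τ) p : ℚ_[p])).order ∧
      (padicLFunction f (unitRoot (E τ) p : ℚ_[p])).order = 2 :=
  squeeze_at_two_of_kato (E τ) hK hp hord hκ hγ hγ' hf Dsel
    (regulator_ne_zero_of_index_zero param coeff hcoeff hreg hcert τ) hle

/-- **Cofinite form.** On an analytic class with injective positions and ONE non-degenerate member `τ₀`, the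
degenerate set `{τ : Reg_p(τ) = 0}` is finite and OFF it the six-way door holds for every member satisfying the
standing hypotheses. CONDITIONAL on PRS, BCS. [cite: Gouvea1993PadicNumbers, §5.6 Cor. 5.6.3] [cite: BalakrishnanMullerStein2015, Thm. 1.7] -/
theorem order_eq_two_iff_selmerCorank_le_two_of_cofinite (hcoeff : Tendsto coeff atTop (𝓝 0))
    (hreg : ∀ τ, padicRegulatorOf (Dh τ) ![P τ, Q τ] = ∑' n, coeff n * (param τ : ℚ_[p]) ^ n)
    (hinj : Function.Injective param) {τ₀ : T} (h₀ : padicRegulatorOf (Dh τ₀) ![P τ₀, Q τ₀] ≠ 0)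
    (h85 : Schneider1985_order_charGenerator)
    (hBCS : burungale_castella_skinner_charIdeal_eq_padicLFunction) (hp : 5 ≤ p) :
    {τ : T | padicRegulatorOf (Dh τ) ![P τ, Q τ] = 0}.Finite ∧
      ∀ τ ∉ {τ : T | padicRegulatorOf (Dh τ) ![P τ, Q τ] = 0},
        (E τ).HasGoodReductionAtPrime p → ¬ (p : ℤ) ∣ (E τ).frobeniusTrace p →
        (E τ).HasIrreducibleModPGaloisRep p → ∀ {N : ℕ} [NeZero N] {f : CuspForm (Gamma0 N) 2},
        IsNewformOf (E τ) f → (Dh τ).IsCanonical →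
          ((padicLFunction f (unitRoot (E τ) p : ℚ_[p])).order = 2 ↔ (E τ).selmerCorank p ≤ 2) :=
  ⟨finite_degenerate_of_exists_ne_zero param coeff hcoeff hreg hinj h₀,
    fun τ hτ hgood hord hirr _ _ _ hf hDh ↦
      order_eq_two_iff_selmerCorank_le_two (E τ) h85 hBCS hp hgood hord hirr hf hDh hτ⟩

end Class

end Summit.BirchSwinnertonDyer.BirchSwinnertonDyer.Theorems.PencilClassCorankDoor

end
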